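import Summits.HubbardSuperconductivity.HubbardSuperconductivity.Theorems.NodalWardXYNodalPropagatorDecayTauBound
import Summits.HubbardSuperconductivity.HubbardSuperconductivity.Theorems.NodalWardXYNodalPropagatorDecayProfileIntegral

/-!
# Nodal propagator decay (route `NodalWardXY`, item `NodalPropagatorDecay`): V. the `x`-decay

`‖∫_{[-π,π]²} Φ‖ ≤ C(μ,Δ₀)/m₀²` for `m₀ ≠ 0` (`norm_integral_le_x0`).  Proof: Fubini with the
`p₁`-integral inside; on the momentum line `p₂ = const` (non-nodal, i.e. `|p₂| ≠ n₀`, a.e.) the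
integrand is `e^{ip₂m₁} · e^{ip₁m₀} · prof⟪l,α,β,γ, a cos p₁ + b⟫` (file III) with
`a ≤ A₀/δ`, `δ = ||p₂| - n₀|` (cosine-difference bound), so by `profile_fourier_bound` (file I-c)
the inner integral is `≤ min(480/|m₀|, (2160 + 480B²/δ²)/|m₀|³)`, `B = 5A₀`; the two bounds combine
to the Cauchy majorant `2160/|m₀|³ + (960/|m₀|)(1 + (|m₀|δ/B)²)⁻¹`, whose `dp₂`-integral is
`≤ (4320π + 1920πB)/m₀²`.  No definitions.
-/

noncomputable section

namespace Summit.HubbardSuperconductivity.HubbardSuperconductivity.Theorems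

namespace NodalDecay

open Real MeasureTheory intervalIntegral

local notation "ρ⟪" s "⟫" => Real.sqrt (1 + s ^ 2)
local notation "P0⟪" l ", " s "⟫" => Real.exp (-(l * ρ⟪s⟫))
local notation "Q0⟪" α ", " β ", " γ ", " s "⟫" => γ + (α + β * s) / ρ⟪s⟫
local notation "prof⟪" l ", " α ", " β ", " γ ", " s "⟫" => P0⟪l, s⟫ * Q0⟪α, β, γ, s⟫

/-- The phase `e^{i n θ}` written exactly as it appears in the item (`exp (I · ↑(θ · n))`). -/
local notation "e⟪" n ", " θ "⟫" => Complex.exp (Complex.I * (((θ : ℝ) * ((n : ℤ) : ℝ) : ℝ) : ℂ))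

/-! ### The integrand of the item (local notation) -/

local notation "ξ⟪" μ ", " p "⟫" => -2 * (Real.cos (Prod.fst p) + Real.cos (Prod.snd p)) - μ
local notation "Δ⟪" Δ₀ ", " p "⟫" => 2 * Δ₀ * (Real.cos (Prod.fst p) - Real.cos (Prod.snd p))
local notation "E⟪" μ ", " Δ₀ ", " p "⟫" => Real.sqrt (ξ⟪μ, p⟫ ^ 2 + Δ⟪Δ₀, p⟫ ^ 2)
local notation "W⟪" μ ", " Δ₀ ", " j ", " p "⟫" =>
  (![(1:ℝ), ξ⟪μ, p⟫ / E⟪μ, Δ₀, p⟫, Δ⟪Δ₀, p⟫ / E⟪μ, Δ₀, p⟫] : Fin 3 → ℝ) j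
local notation "Φ⟪" μ ", " Δ₀ ", " m₀ ", " m₁ ", " τ ", " j ", " p "⟫" =>
  Complex.exp (Complex.I * (((Prod.fst p) * ((m₀ : ℤ) : ℝ) + (Prod.snd p) * ((m₁ : ℤ) : ℝ) : ℝ) : ℂ))
    * ((Real.exp (-|τ| * E⟪μ, Δ₀, p⟫) : ℝ) : ℂ) * ((W⟪μ, Δ₀, j, p⟫ : ℝ) : ℂ)
set_option quotPrecheck false in
local notation "box" => Set.Icc (-Real.pi) Real.pi ×ˢ Set.Icc (-Real.pi) Real.pi


/-! ### The three Nambu weights, case by case -/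

/-- The weight `w_j` is one of `1`, `ξ/E`, `Δ/E` (uniformly in the momentum). -/
theorem weight_cases (j : Fin 3) :
    (∀ (μ Δ₀ : ℝ) (p : ℝ × ℝ), W⟪μ, Δ₀, j, p⟫ = 1) ∨
    (∀ (μ Δ₀ : ℝ) (p : ℝ × ℝ), W⟪μ, Δ₀, j, p⟫ = ξ⟪μ, p⟫ / E⟪μ, Δ₀, p⟫) ∨
    (∀ (μ Δ₀ : ℝ) (p : ℝ × ℝ), W⟪μ, Δ₀, j, p⟫ = Δ⟪Δ₀, p⟫ / E⟪μ, Δ₀, p⟫) := by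
  fin_cases j
  · left; intro μ Δ₀ p; simp
  · right; left; intro μ Δ₀ p; simp
  · right; right; intro μ Δ₀ p; simp [Matrix.cons_val]

/-- The integrand is measurable. -/
theorem measurable_integrand (μ Δ₀ : ℝ) (m₀ m₁ : ℤ) (τ : ℝ) (j : Fin 3) :
    Measurable fun p : ℝ × ℝ => Φ⟪μ, Δ₀, m₀, m₁, τ, j, p⟫ := by
  have hξ : Measurable fun p : ℝ × ℝ => ξ⟪μ, p⟫ :=
    (by fun_prop : Continuous fun p : ℝ × ℝ => ξ⟪μ, p⟫).measurable
  have hΔ : Measurable fun p : ℝ × ℝ => Δ⟪Δ₀, p⟫ :=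
    (by fun_prop : Continuous fun p : ℝ × ℝ => Δ⟪Δ₀, p⟫).measurable
  have hE : Measurable fun p : ℝ × ℝ => E⟪μ, Δ₀, p⟫ :=
    (Real.continuous_sqrt.comp (by fun_prop : Continuous fun p : ℝ × ℝ => ξ⟪μ, p⟫ ^ 2 + Δ⟪Δ₀, p⟫ ^ 2)).measurable
  have hexp : Measurable fun p : ℝ × ℝ => ((Real.exp (-|τ| * E⟪μ, Δ₀, p⟫) : ℝ) : ℂ) :=
    Complex.measurable_ofReal.comp (Real.measurable_exp.comp (measurable_const.mul hE))
  have hW : Measurable fun p : ℝ × ℝ => ((W⟪μ, Δ₀, j, p⟫ : ℝ) : ℂ) := by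
    refine Complex.measurable_ofReal.comp ?_
    rcases weight_cases j with h | h | h <;> simp_rw [h]
    · exact measurable_const
    · exact hξ.div hE
    · exact hΔ.div hE
  have hph : Measurable fun p : ℝ × ℝ =>
      Complex.exp (Complex.I * (((Prod.fst p) * ((m₀ : ℤ) : ℝ) + (Prod.snd p) * ((m₁ : ℤ) : ℝ) : ℝ) : ℂ)) :=
    (by fun_prop : Continuous fun p : ℝ × ℝ =>
      Complex.exp (Complex.I * (((Prod.fst p) * ((m₀ : ℤ) : ℝ) + (Prod.snd p) * ((m₁ : ℤ) : ℝ) : ℝ) : ℂ))).measurable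
  exact (hph.mul hexp).mul hW

/-- The integrand is integrable on the momentum box. -/
theorem integrableOn_integrand (μ Δ₀ : ℝ) (m₀ m₁ : ℤ) (τ : ℝ) (j : Fin 3) :
    IntegrableOn (fun p : ℝ × ℝ => Φ⟪μ, Δ₀, m₀, m₁, τ, j, p⟫) (box) := by
  have hvol : MeasureTheory.volume (box) ≠ ⊤ := by
    rw [volume_box]; exact (ENNReal.mul_lt_top ENNReal.ofReal_lt_top ENNReal.ofReal_lt_top).ne
  exact Measure.integrableOn_of_bounded hvol
    (measurable_integrand μ Δ₀ m₀ m₁ τ j).aestronglyMeasurable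
    (ae_of_all _ (fun p => norm_integrand_le_one μ Δ₀ m₀ m₁ τ j p))

/-- On a non-nodal momentum line `p₂ = const`, `e^{-|τ|E} w_j` is the universal profile of
`a cos p₁ + b` with `a = (1 + Δ₀²)/(2Δ₀|cos p₂ + μ/4|)` (per weight `j`). -/
theorem line_profile_weight (μ Δ₀ τ p₂ : ℝ) (hΔ : 0 < Δ₀) (hc : Real.cos p₂ + μ / 4 ≠ 0) (j : Fin 3) :
    ∃ l α β γ a b : ℝ, 0 ≤ l ∧ |α| ≤ 1 ∧ |β| ≤ 1 ∧ |γ| ≤ 1 ∧ 0 < a ∧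
      a = (1 + Δ₀ ^ 2) / (2 * Δ₀ * |Real.cos p₂ + μ / 4|) ∧
      ∀ p₁ : ℝ, Real.exp (-|τ| * E⟪μ, Δ₀, (p₁, p₂)⟫) * W⟪μ, Δ₀, j, (p₁, p₂)⟫
        = prof⟪l, α, β, γ, a * Real.cos p₁ + b⟫ := by
  obtain ⟨l, α₁, β₁, α₂, β₂, a, b, hl, hα₁, hβ₁, hα₂, hβ₂, ha, ha_eq, hall⟩ :=
    bdg_line_profile μ Δ₀ τ p₂ hΔ hc
  rcases weight_cases j with h | h | h
  · refine ⟨l, 0, 0, 1, a, b, hl, by simp, by simp, by simp, ha, ha_eq, fun p₁ => ?_⟩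
    rw [h, mul_one]
    dsimp only
    rw [(hall p₁).1]
    ring
  · refine ⟨l, α₁, β₁, 0, a, b, hl, hα₁, hβ₁, by simp, ha, ha_eq, fun p₁ => ?_⟩
    rw [h]
    exact (hall p₁).2.1
  · refine ⟨l, α₂, β₂, 0, a, b, hl, hα₂, hβ₂, by simp, ha, ha_eq, fun p₁ => ?_⟩
    rw [h]
    exact (hall p₁).2.2

/-! ### Real-variable bookkeeping for the `x`-decay bound -/

/-- Two bounds `N ≤ P` and `N ≤ R + Q/δ²` combine to `N ≤ R + 2PQ/(Pδ² + Q)`. -/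
theorem le_add_harmonic {N P Q R δ : ℝ} (hP : 0 < P) (hQ : 0 < Q) (hδ : 0 < δ) (hR : 0 ≤ R)
    (h1 : N ≤ P) (h2 : N ≤ R + Q / δ ^ 2) : N ≤ R + 2 * P * Q / (P * δ ^ 2 + Q) := by
  rcases le_or_gt (N - R) 0 with hneg | hpos
  · have : 0 ≤ 2 * P * Q / (P * δ ^ 2 + Q) := by positivity
    linarith
  · have hA : (N - R) * Q ≤ P * Q := by nlinarith
    have hB : (N - R) * (P * δ ^ 2) ≤ P * Q := by
      have : (N - R) * δ ^ 2 ≤ Q := by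
        rw [← le_div_iff₀ (by positivity)]; linarith
      nlinarith
    have hden : 0 < P * δ ^ 2 + Q := by positivity
    rw [← sub_le_iff_le_add', le_div_iff₀ hden]
    nlinarith

/-- `(1 + (r(|t| - n₀))²)⁻¹ ≤ (1 + (r(t - n₀))²)⁻¹ + (1 + (r(t + n₀))²)⁻¹`. -/
theorem inv_one_add_sq_abs_le (r t n₀ : ℝ) :
    (1 + (r * (|t| - n₀)) ^ 2)⁻¹ ≤ (1 + (r * (t - n₀)) ^ 2)⁻¹ + (1 + (r * (t + n₀)) ^ 2)⁻¹ := by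
  have h1 : 0 ≤ (1 + (r * (t - n₀)) ^ 2)⁻¹ := by positivity
  have h2 : 0 ≤ (1 + (r * (t + n₀)) ^ 2)⁻¹ := by positivity
  rcases le_or_gt 0 t with h | h
  · rw [abs_of_nonneg h]; linarith
  · rw [abs_of_neg h, show (r * (-t - n₀)) ^ 2 = (r * (t + n₀)) ^ 2 by ring]; linarith

/-- `∫_ℝ (1 + (r(t - n₀))²)⁻¹ dt = π/r` for `r > 0`, with integrability. -/
theorem integral_inv_one_add_sq_affine {r : ℝ} (hr : 0 < r) (n₀ : ℝ) :
    Integrable (fun t : ℝ => (1 + (r * (t - n₀)) ^ 2)⁻¹) ∧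
      ∫ t : ℝ, (1 + (r * (t - n₀)) ^ 2)⁻¹ = π / r := by
  constructor
  · exact (integrable_inv_one_add_sq.comp_mul_left' hr.ne').comp_sub_right n₀
  · rw [integral_sub_right_eq_self (fun t => (1 + (r * t) ^ 2)⁻¹) n₀,
      Measure.integral_comp_mul_left (fun u => (1 + u ^ 2)⁻¹) r, integral_univ_inv_one_add_sq,
      abs_of_pos (inv_pos.2 hr), smul_eq_mul]
    field_simp

/-! ### The `x`-decay bound -/

/-- **`x`-decay in the first lattice coordinate.**  For `μ ∈ (-4,4)` and `Δ₀ > 0` there is `C`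
with `‖∫_{[-π,π]²} Φ‖ ≤ C / m₀²` for all `m₀ ≠ 0` (and all `m₁, τ, j`). -/
theorem norm_integral_le_x0 {μ Δ₀ : ℝ} (hμ : μ ∈ Set.Ioo (-4 : ℝ) 4) (hΔ : 0 < Δ₀) :
    ∃ C : ℝ, ∀ (m₀ m₁ : ℤ) (τ : ℝ) (j : Fin 3), m₀ ≠ 0 →
      ‖∫ p in box, Φ⟪μ, Δ₀, m₀, m₁, τ, j, p⟫‖ ≤ C / (m₀ : ℝ) ^ 2 := by
  -- the node angle and the cosine-difference constant
  obtain ⟨n₀, hn₀⟩ : ∃ n₀ : ℝ, n₀ = Real.arccos (-μ / 4) := ⟨_, rfl⟩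
  have hn₀pos : 0 < n₀ := hn₀ ▸ Real.arccos_pos.2 (by linarith [hμ.1, hμ.2])
  have hn₀pi : n₀ < π := hn₀ ▸ Real.arccos_lt_pi.2 (by linarith [hμ.1, hμ.2])
  have hcosn₀ : Real.cos n₀ = -μ / 4 :=
    hn₀ ▸ Real.cos_arccos (by linarith [hμ.1, hμ.2]) (by linarith [hμ.1, hμ.2])
  obtain ⟨κ, hκ, hcos⟩ := abs_cos_sub_cos_ge hn₀pos hn₀pi
  obtain ⟨A₀, hA₀⟩ : ∃ A₀ : ℝ, A₀ = (1 + Δ₀ ^ 2) / (2 * Δ₀ * κ) := ⟨_, rfl⟩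
  have hA₀pos : 0 < A₀ := by rw [hA₀]; positivity
  obtain ⟨B, hB⟩ : ∃ B : ℝ, B = 5 * A₀ := ⟨_, rfl⟩
  have hBpos : 0 < B := by rw [hB]; positivity
  have hBA : 8400 * A₀ ^ 2 ≤ 480 * B ^ 2 := by rw [hB]; nlinarith [sq_nonneg A₀]
  refine ⟨4320 * π + 1920 * π * B, fun m₀ m₁ τ j hm => ?_⟩
  -- M = |m₀| ≥ 1
  obtain ⟨M, hM⟩ : ∃ M : ℝ, M = |(m₀ : ℝ)| := ⟨_, rfl⟩
  have hmR : (m₀ : ℝ) ≠ 0 := Int.cast_ne_zero.2 hm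
  have hMpos : 0 < M := by rw [hM]; exact abs_pos.2 hmR
  have hM0 : M ≠ 0 := hMpos.ne'
  have hB0 : B ≠ 0 := hBpos.ne'
  have hM1 : 1 ≤ M := by
    rw [hM, ← Int.cast_abs]; exact_mod_cast Int.one_le_abs hm
  have hM2 : (m₀ : ℝ) ^ 2 = M ^ 2 := by rw [hM, sq_abs]
  -- constants of the majorant
  obtain ⟨r, hr⟩ : ∃ r : ℝ, r = M / B := ⟨_, rfl⟩
  have hrpos : 0 < r := by rw [hr]; positivity
  obtain ⟨P, hP⟩ : ∃ P : ℝ, P = 480 / M := ⟨_, rfl⟩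
  have hPpos : 0 < P := by rw [hP]; positivity
  obtain ⟨c₀, hc₀⟩ : ∃ c₀ : ℝ, c₀ = 2160 / M ^ 3 := ⟨_, rfl⟩
  have hc₀nn : 0 ≤ c₀ := by rw [hc₀]; positivity
  obtain ⟨C₁, hC₁⟩ : ∃ C₁ : ℝ, C₁ = 960 / M := ⟨_, rfl⟩
  have hC₁nn : 0 ≤ C₁ := by rw [hC₁]; positivity
  obtain ⟨Q, hQ⟩ : ∃ Q : ℝ, Q = 480 * B ^ 2 / M ^ 3 := ⟨_, rfl⟩
  have hQpos : 0 < Q := by rw [hQ]; positivity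
  obtain ⟨G, hG⟩ : ∃ G : ℝ → ℝ, G = fun t =>
      c₀ + C₁ * (1 + (r * (t - n₀)) ^ 2)⁻¹ + C₁ * (1 + (r * (t + n₀)) ^ 2)⁻¹ := ⟨_, rfl⟩
  -- Step 1: Fubini, inner integral over p₁
  have hint := integrableOn_integrand μ Δ₀ m₀ m₁ τ j
  rw [IntegrableOn, Measure.volume_eq_prod, ← Measure.prod_restrict] at hint
  have hF : ∫ p in box, Φ⟪μ, Δ₀, m₀, m₁, τ, j, p⟫ =
      ∫ p₂ in Set.Icc (-π) π, ∫ p₁ in Set.Icc (-π) π, Φ⟪μ, Δ₀, m₀, m₁, τ, j, (p₁, p₂)⟫ := by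
    rw [Measure.volume_eq_prod, ← Measure.prod_restrict]
    exact integral_prod_symm _ hint
  -- Step 2: bound of the inner integral for non-nodal p₂
  have hinner : ∀ p₂ : ℝ, p₂ ∈ Set.Icc (-π) π → |p₂| ≠ n₀ →
      ‖∫ p₁ in Set.Icc (-π) π, Φ⟪μ, Δ₀, m₀, m₁, τ, j, (p₁, p₂)⟫‖ ≤ G p₂ := by
    intro p₂ hp₂ hne
    have hp₂π : |p₂| ≤ π := abs_le.2 ⟨hp₂.1, hp₂.2⟩
    obtain ⟨δ, hδ⟩ : ∃ δ : ℝ, δ = |(|p₂| - n₀)| := ⟨_, rfl⟩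
    have hδpos : 0 < δ := by rw [hδ]; exact abs_pos.2 (sub_ne_zero.2 hne)
    have hcδ : κ * δ ≤ |Real.cos p₂ + μ / 4| := by
      have := hcos p₂ hp₂π
      rwa [hcosn₀, show Real.cos p₂ - -μ / 4 = Real.cos p₂ + μ / 4 by ring, ← hδ] at this
    have hc : Real.cos p₂ + μ / 4 ≠ 0 := by
      intro h0; rw [h0, abs_zero] at hcδ; nlinarith
    obtain ⟨l, α, β, γ, a, b, hl, hα, hβ, hγ, ha, ha_eq, hprof⟩ :=
      line_profile_weight μ Δ₀ τ p₂ hΔ hc j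
    -- rewrite the inner integrand through the profile
    have hpt : ∀ p₁ : ℝ, Φ⟪μ, Δ₀, m₀, m₁, τ, j, (p₁, p₂)⟫ =
        Complex.exp (Complex.I * (((p₂ * ((m₁ : ℤ) : ℝ)) : ℝ) : ℂ)) *
          (e⟪m₀, p₁⟫ * ((prof⟪l, α, β, γ, a * Real.cos p₁ + b⟫ : ℝ) : ℂ)) := by
      intro p₁
      rw [← hprof p₁, mul_assoc, ← Complex.ofReal_mul]
      dsimp only
      rw [Complex.ofReal_add, mul_add, Complex.exp_add]
      ring
    simp_rw [hpt]
    rw [MeasureTheory.integral_const_mul, norm_mul, norm_phase, one_mul, integral_Icc_eq_integral_Ioc,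
      ← intervalIntegral.integral_of_le (by linarith [Real.pi_pos])]
    obtain ⟨hb1, hb3⟩ := profile_fourier_bound hl hα hβ hγ ha.le b hm
    rw [← hM] at hb1 hb3
    obtain ⟨N, hN⟩ : ∃ N : ℝ,
        N = ‖∫ θ in (-π)..π, e⟪m₀, θ⟫ * ((prof⟪l, α, β, γ, a * Real.cos θ + b⟫ : ℝ) : ℂ)‖ := ⟨_, rfl⟩
    rw [← hN] at hb1 hb3 ⊢
    rw [← hP] at hb1
    -- a ≤ A₀ / δ
    have haA : a ≤ A₀ / δ := by
      rw [ha_eq, hA₀, div_div, div_le_div_iff₀ (by positivity) (by positivity)]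
      have : (1 + Δ₀ ^ 2) * (2 * Δ₀ * (κ * δ)) ≤ (1 + Δ₀ ^ 2) * (2 * Δ₀ * |Real.cos p₂ + μ / 4|) := by
        gcongr
      linarith
    -- second bound in the form c₀ + Q/δ²
    have h2 : N ≤ c₀ + Q / δ ^ 2 := by
      have ha2 : a ^ 2 ≤ A₀ ^ 2 / δ ^ 2 := by
        rw [← div_pow]; exact pow_le_pow_left₀ ha.le haA 2
      have hlin : 2 * (3 * a * 560) ≤ 1680 + 1680 * a ^ 2 := by nlinarith [sq_nonneg (a - 1)]
      have hM3 : 0 < M ^ 3 := by positivity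
      have hnum : 2 * (240 + 3 * a * 560 + a ^ 2 * 3360) ≤ 2160 + 480 * B ^ 2 / δ ^ 2 := by
        have h84 : 8400 * a ^ 2 ≤ 480 * B ^ 2 / δ ^ 2 := by
          calc 8400 * a ^ 2 ≤ 8400 * (A₀ ^ 2 / δ ^ 2) := by gcongr
            _ = 8400 * A₀ ^ 2 / δ ^ 2 := by ring
            _ ≤ 480 * B ^ 2 / δ ^ 2 := by gcongr
        linarith
      calc N ≤ 2 * (240 + 3 * a * 560 + a ^ 2 * 3360) / M ^ 3 := hb3
        _ ≤ (2160 + 480 * B ^ 2 / δ ^ 2) / M ^ 3 := div_le_div_of_nonneg_right hnum hM3.le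
        _ = c₀ + Q / δ ^ 2 := by rw [hc₀, hQ]; field_simp
    -- combine the two bounds
    have hcomb := le_add_harmonic hPpos hQpos hδpos hc₀nn hb1 h2
    have halg : 2 * P * Q / (P * δ ^ 2 + Q) = C₁ * (1 + (r * (|p₂| - n₀)) ^ 2)⁻¹ := by
      have e1 : (r * (|p₂| - n₀)) ^ 2 = (r * δ) ^ 2 := by rw [hδ, mul_pow, mul_pow, sq_abs]
      rw [e1, hP, hQ, hC₁, hr]
      have hδ0 : δ ≠ 0 := hδpos.ne'
      field_simp
      ring
    rw [halg] at hcomb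
    have hsum := inv_one_add_sq_abs_le r p₂ n₀
    calc N ≤ c₀ + C₁ * (1 + (r * (|p₂| - n₀)) ^ 2)⁻¹ := hcomb
      _ ≤ c₀ + C₁ * ((1 + (r * (p₂ - n₀)) ^ 2)⁻¹ + (1 + (r * (p₂ + n₀)) ^ 2)⁻¹) := by gcongr
      _ = G p₂ := by rw [hG]; ring
  -- Step 3: almost every p₂ is non-nodal
  have hae : ∀ᵐ p₂ ∂(MeasureTheory.volume.restrict (Set.Icc (-π) π)),
      ‖∫ p₁ in Set.Icc (-π) π, Φ⟪μ, Δ₀, m₀, m₁, τ, j, (p₁, p₂)⟫‖ ≤ G p₂ := by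
    have hnull : ∀ᵐ p₂ ∂(MeasureTheory.volume : Measure ℝ), p₂ ∉ ({n₀, -n₀} : Set ℝ) :=
      (Set.toFinite _).countable.ae_notMem _
    rw [ae_restrict_iff' measurableSet_Icc]
    filter_upwards [hnull] with p₂ hp₂ hmem
    refine hinner p₂ hmem (fun h => hp₂ ?_)
    rcases (abs_eq hn₀pos.le).1 h with h' | h'
    · exact Or.inl h'
    · exact Or.inr h'
  -- Step 4: integrate the majorant
  obtain ⟨hg1_int, hg1_val⟩ := integral_inv_one_add_sq_affine hrpos n₀
  obtain ⟨hg2_int, hg2_val⟩ := integral_inv_one_add_sq_affine hrpos (-n₀)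
  simp only [sub_neg_eq_add] at hg2_int hg2_val
  have hI0 : Integrable (fun _ : ℝ => c₀) (MeasureTheory.volume.restrict (Set.Icc (-π) π)) :=
    continuous_const.integrableOn_Icc
  have hI1 : Integrable (fun t : ℝ => C₁ * (1 + (r * (t - n₀)) ^ 2)⁻¹)
      (MeasureTheory.volume.restrict (Set.Icc (-π) π)) := (hg1_int.const_mul C₁).integrableOn
  have hI2 : Integrable (fun t : ℝ => C₁ * (1 + (r * (t + n₀)) ^ 2)⁻¹)
      (MeasureTheory.volume.restrict (Set.Icc (-π) π)) := (hg2_int.const_mul C₁).integrableOn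
  have hI01 : Integrable (fun t : ℝ => c₀ + C₁ * (1 + (r * (t - n₀)) ^ 2)⁻¹)
      (MeasureTheory.volume.restrict (Set.Icc (-π) π)) := hI0.add hI1
  have hG_int : Integrable G (MeasureTheory.volume.restrict (Set.Icc (-π) π)) := by
    rw [hG]; exact hI01.add hI2
  have hGval : ∫ p₂ in Set.Icc (-π) π, G p₂ ≤ (4320 * π + 1920 * π * B) / (m₀ : ℝ) ^ 2 := by
    have hsplit : ∫ p₂ in Set.Icc (-π) π, G p₂ = (∫ p₂ in Set.Icc (-π) π, c₀)
        + (∫ p₂ in Set.Icc (-π) π, C₁ * (1 + (r * (p₂ - n₀)) ^ 2)⁻¹)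
        + ∫ p₂ in Set.Icc (-π) π, C₁ * (1 + (r * (p₂ + n₀)) ^ 2)⁻¹ := by
      rw [hG, integral_add hI01 hI2, integral_add hI0 hI1]
    have hconst : ∫ p₂ in Set.Icc (-π) π, c₀ = 2 * π * c₀ := by
      rw [setIntegral_const, Real.volume_real_Icc, smul_eq_mul,
        max_eq_left (by linarith [Real.pi_pos])]
      ring
    have hJ1 : ∫ p₂ in Set.Icc (-π) π, C₁ * (1 + (r * (p₂ - n₀)) ^ 2)⁻¹ ≤ C₁ * (π / r) := by
      calc ∫ p₂ in Set.Icc (-π) π, C₁ * (1 + (r * (p₂ - n₀)) ^ 2)⁻¹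
          ≤ ∫ p₂, C₁ * (1 + (r * (p₂ - n₀)) ^ 2)⁻¹ :=
            setIntegral_le_integral (hg1_int.const_mul C₁)
              (Filter.Eventually.of_forall fun t => by positivity)
        _ = C₁ * (π / r) := by rw [MeasureTheory.integral_const_mul, hg1_val]
    have hJ2 : ∫ p₂ in Set.Icc (-π) π, C₁ * (1 + (r * (p₂ + n₀)) ^ 2)⁻¹ ≤ C₁ * (π / r) := by
      calc ∫ p₂ in Set.Icc (-π) π, C₁ * (1 + (r * (p₂ + n₀)) ^ 2)⁻¹
          ≤ ∫ p₂, C₁ * (1 + (r * (p₂ + n₀)) ^ 2)⁻¹ :=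
            setIntegral_le_integral (hg2_int.const_mul C₁)
              (Filter.Eventually.of_forall fun t => by positivity)
        _ = C₁ * (π / r) := by rw [MeasureTheory.integral_const_mul, hg2_val]
    have h23 : 4320 * π / M ^ 3 ≤ 4320 * π / M ^ 2 := by
      apply div_le_div_of_nonneg_left (by positivity) (by positivity)
      calc M ^ 2 = M ^ 2 * 1 := by ring
        _ ≤ M ^ 2 * M := by gcongr
        _ = M ^ 3 := by ring
    calc ∫ p₂ in Set.Icc (-π) π, G p₂ ≤ 2 * π * c₀ + C₁ * (π / r) + C₁ * (π / r) := by
          rw [hsplit, hconst]; linarith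
      _ = 4320 * π / M ^ 3 + 1920 * π * B / M ^ 2 := by
          rw [hc₀, hC₁, hr]; field_simp; ring
      _ ≤ 4320 * π / M ^ 2 + 1920 * π * B / M ^ 2 := by linarith
      _ = (4320 * π + 1920 * π * B) / (m₀ : ℝ) ^ 2 := by rw [hM2]; ring
  -- conclusion
  calc ‖∫ p in box, Φ⟪μ, Δ₀, m₀, m₁, τ, j, p⟫‖
      = ‖∫ p₂ in Set.Icc (-π) π, ∫ p₁ in Set.Icc (-π) π, Φ⟪μ, Δ₀, m₀, m₁, τ, j, (p₁, p₂)⟫‖ := by rw [hF]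
    _ ≤ ∫ p₂ in Set.Icc (-π) π, G p₂ := norm_integral_le_of_norm_le hG_int hae
    _ ≤ (4320 * π + 1920 * π * B) / (m₀ : ℝ) ^ 2 := hGval

end NodalDecay

end Summit.HubbardSuperconductivity.HubbardSuperconductivity.Theorems
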